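import Summits.AnomalousDissipation.AnomalousDissipation.Theorems.SawtoothPulseCascadeApproxEnvelopeBox
import Literature.MathematicalPhysics.QuantumFieldTheory.Balaban1983to89.T4FlagMemoryPolyWeight

/-!
# ApproxSol58, registered stub `stub_responseL2`: the forced linearised response is `o(ν)` in `L²_t L²_x`
(route `AnomalousDissipation/SawtoothPulseCascade`; crux ApproxSol58 = stmt-AnomalousDissipation-19688, line
`linear-response` of planner ad-p2 g12, skeleton sha16 92ef84898a53cf63)

**Theorem (`stub_responseL2`, the registered signature verbatim).**  Assuming K2″ on the box
(`∀ γ ∈ [4,8], ∀ ρN ∈ {2..7}, K2PhaseGrowthClassical ⟨γ,1/4,2,1,ρN⟩ 3`): for every `(γ, ρN) ∈ [5,8] × {2,…,7}`, every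
lag `A` and `ε > 0` there is `ν₀ > 0` such that for all `ν ∈ (0, ν₀]`, every window `horizon < T' < 1` and every
classical solution `(L, q)` of the heat-lag-forced linearised equations on `[0, T']` from zero,
`∫₀^{horizon (γ²−3) ν A} ∫‖L(s)‖² ds ≤ ε ν`.

Proof: the geometric envelope `√∫‖L(t)‖² ≤ Kν(j+1)M₂^{j+1}` of `…ApproxEnvelopeBox.responseL2Envelope`
(`M₂ < r := γ² − 3`), uniformly `≤ Kν·c·ρ^{J}` up to the horizon phase `J = J_r(ν) + A` with `ρ = (M₂ ∨ 1 + r)/2 < r`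
(`(J+1)x^J ≤ 1/(1−x)`), and `ν·(ρ²)^{J_r(ν)} ≤ ρ² ν^{1 − log ρ/log r}` (`mul_pow_Jrate_le`), so the time integral is
`O(ν^{2−θ})` with `θ < 1`.
-/

set_option linter.dupNamespace false

noncomputable section

namespace Summit.AnomalousDissipation.AnomalousDissipation.Theorems.SawtoothPulseCascade.ApproxResponse

open Set MeasureTheory UnitAddTorus
open scoped ContDiff InnerProductSpace
open Literature.Analysis Literature.Analysis.FunctionSpaces Literature.Analysis.FluidPDE
open Literature.Analysis.FluidPDE.SawtoothCascade
open Literature.Analysis.FluidPDE.SawtoothCascade.CascadeParams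
open Literature.Analysis.FluidPDE.SawtoothCascade.DriftFree

/-! ## §1 Locating the phase of a time (the bound `(J+1)x^J ≤ 1/(1−x)` is the tree's
`T4FlagMemoryPolyWeight.succ_mul_pow_le`) -/

/-- Every `t ∈ [0, tStart J]` (`J ≥ 1`) lies in some phase `j < J`. -/
theorem exists_phase {t : ℝ} (ht0 : 0 ≤ t) {J : ℕ} (hJ : 0 < J) (htJ : t ≤ tStart J) :
    ∃ j < J, t ∈ Icc (tStart j) (tStart (j + 1)) := by
  have hK : CascadeParams.tInject (2 * J / 2) (2 * J % 2 == 0) = tStart J := slotStart_even J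
  obtain ⟨k, hk, htk, -⟩ := exists_slot ht0 (by omega : 0 < 2 * J) (by rw [hK]; exact htJ)
  exact ⟨k / 2, by omega, (tStart_half_le_slotStart k).trans htk.1, htk.2.trans (slotStart_succ_le_tStart k)⟩

/-! ## §2 The registered stub -/

set_option maxHeartbeats 400000 in
/-- **ApproxSol58, stub `stub_responseL2` (registered signature).**  K2″ on the box implies: for every
`(γ, ρN) ∈ [5,8] × {2,…,7}`, lag `A`, and `ε > 0`, for all sufficiently small `ν`, every classical forced
linearised response `(L, q)` from zero on a window `[0, T']` beyond the horizon satisfies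
`∫₀^{horizon} ∫‖L(s)‖² ds ≤ ε ν`. -/
theorem stub_responseL2 :
    (∀ γ ∈ Set.Icc (4 : ℝ) 8, ∀ ρN ∈ Finset.Icc 2 7,
        Literature.Analysis.FluidPDE.SawtoothCascade.K2PhaseGrowthClassical ⟨γ, 1 / 4, 2, 1, ρN⟩ 3) →
    ∀ γ ∈ Set.Icc (5 : ℝ) 8, ∀ ρN ∈ Finset.Icc 2 7, ∀ A : ℕ, ∀ ε : ℝ, 0 < ε →
      ∃ ν₀ : ℝ, 0 < ν₀ ∧ ∀ ν ∈ Set.Ioc 0 ν₀, ∀ T' : ℝ,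
        Literature.Analysis.FluidPDE.SawtoothCascade.DriftFree.horizon (γ ^ 2 - 3) ν A < T' → T' < 1 →
        ∀ (L : ℝ → UnitAddTorus (Fin 2) → EuclideanSpace ℝ (Fin 2)) (q : ℝ → UnitAddTorus (Fin 2) → ℝ),
          FunctionSpaces.Torus.IsSmoothSpaceTimeOn (Set.Icc 0 T') L →
          FunctionSpaces.Torus.IsSmoothSpaceTimeOn (Set.Icc 0 T') q →
          (∀ t ∈ Set.Icc 0 T', FunctionSpaces.Torus.IsDivFree (L t)) → L 0 = 0 →
          (∀ t ∈ Set.Icc 0 T', ∀ x,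
            FunctionSpaces.Torus.timeDerivWithin (Set.Icc 0 T') L t x +
                FunctionSpaces.Torus.convect ((⟨γ, 1 / 4, 2, 1, ρN⟩ : CascadeParams).field t) (L t) x +
                FunctionSpaces.Torus.convect (L t) ((⟨γ, 1 / 4, 2, 1, ρN⟩ : CascadeParams).field t) x =
              ν • FunctionSpaces.Torus.laplacian (L t) x - FunctionSpaces.Torus.gradient (q t) x +
                ν • FunctionSpaces.Torus.laplacian ((⟨γ, 1 / 4, 2, 1, ρN⟩ : CascadeParams).field t) x) →
          (∫ s in (0 : ℝ)..Literature.Analysis.FluidPDE.SawtoothCascade.DriftFree.horizon (γ ^ 2 - 3) ν A,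
              FluidPDE.Torus.vectorL2Sq (L s)) ≤ ε * ν := by
  intro hK2 γ hγ ρN hρN A ε hε
  have hγ4 : γ ∈ Set.Icc (4 : ℝ) 8 := ⟨le_trans (by norm_num) hγ.1, hγ.2⟩
  obtain ⟨M, K, hM0, hMr, hK0, hA⟩ := responseL2Envelope hγ hρN (hK2 γ hγ4 ρN hρN)
  obtain ⟨ν₁, hν₁, hEnv⟩ := hA A
  -- constants
  set r : ℝ := γ ^ 2 - 3 with hr
  have hr22 : 22 ≤ r := by rw [hr]; nlinarith [hγ.1]
  have hr1 : 1 < r := by linarith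
  set M' : ℝ := max M 1 with hM'
  have hM'1 : 1 ≤ M' := le_max_right _ _
  have hMM' : M ≤ M' := le_max_left _ _
  have hM'r : M' < r := max_lt hMr (by linarith)
  set ρ : ℝ := (M' + r) / 2 with hρ
  have hρM : M' < ρ := by rw [hρ]; linarith
  have hρr : ρ < r := by rw [hρ]; linarith
  have hρ1 : 1 ≤ ρ := by linarith
  have hρ0 : 0 < ρ := by linarith
  set x : ℝ := M' / ρ with hx
  have hx0 : 0 ≤ x := by rw [hx]; positivity
  have hx1 : x < 1 := by rw [hx, div_lt_one hρ0]; exact hρM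
  set q : ℝ := ρ ^ 2 with hq
  have hq1 : 1 ≤ q := by rw [hq]; nlinarith
  set θ : ℝ := Real.log q / (2 * Real.log r) with hθ
  have hlogr : 0 < Real.log r := Real.log_pos hr1
  have hθ1 : θ < 1 := by
    rw [hθ, div_lt_one (by positivity)]
    have h2 : 2 * Real.log r = Real.log (r ^ 2) := by rw [Real.log_pow]; norm_num
    rw [h2]
    exact Real.log_lt_log (by positivity) (by rw [hq]; nlinarith)
  have h1θ : 0 < 1 - θ := by linarith
  -- the constant `D` with `∫ ≤ D ν^{2-θ}`
  set c₁ : ℝ := M' * (1 / (1 - x)) with hc₁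
  set D : ℝ := (K * c₁) ^ 2 * q ^ (A + 1) + 1 with hD
  have hD0 : 0 < D := by rw [hD]; positivity
  set ν₂ : ℝ := (ε / D) ^ (1 / (1 - θ)) with hν₂
  have hν₂0 : 0 < ν₂ := Real.rpow_pos_of_pos (div_pos hε hD0) _
  refine ⟨min ν₁ (min 1 ν₂), lt_min hν₁ (lt_min one_pos hν₂0),
    fun ν hν T' hT hT'1 L q' hL hq' hdiv hL0 hlin => ?_⟩
  have hν0 : 0 < ν := hν.1
  have hν₁' : ν ∈ Set.Ioc 0 ν₁ := ⟨hν.1, hν.2.trans (min_le_left _ _)⟩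
  have hν1 : ν ≤ 1 := (hν.2.trans (min_le_right _ _)).trans (min_le_left _ _)
  have hνν₂ : ν ≤ ν₂ := (hν.2.trans (min_le_right _ _)).trans (min_le_right _ _)
  set JT : ℕ := Jrate (γ ^ 2 - 3) ν + A with hJT
  have hT_eq : DriftFree.horizon (γ ^ 2 - 3) ν A = tStart JT := rfl
  rw [hT_eq] at hT ⊢
  -- uniform bound on `[0, tStart JT]`
  set B : ℝ := K * ν * (((JT : ℝ) + 1) * M' ^ (JT + 1)) with hB
  have hB0 : 0 ≤ B := by rw [hB]; positivity
  have hunif : ∀ s ∈ Icc (0 : ℝ) (tStart JT), Torus.vectorL2Sq (L s) ≤ B ^ 2 := by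
    intro s hs
    have hV0 : 0 ≤ Torus.vectorL2Sq (L s) := by
      unfold Torus.vectorL2Sq; exact integral_nonneg fun _ => by positivity
    rcases Nat.eq_zero_or_pos JT with hJ0 | hJpos
    · have hs0 : s = 0 := by
        have : tStart JT = 0 := by rw [hJ0]; rfl
        exact le_antisymm (by rw [this] at hs; exact hs.2) hs.1
      rw [hs0, hL0]
      simp [Torus.vectorL2Sq, sq_nonneg]
    obtain ⟨j, hjJ, hsj⟩ := exists_phase hs.1 hJpos hs.2
    have h1 := hEnv ν hν₁' T' hT hT'1 L q' hL hq' hdiv hL0 hlin j s hs hsj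
    have h2 : K * ν * ((j : ℝ) + 1) * M ^ (j + 1) ≤ B := by
      rw [hB]
      have hm : ((j : ℝ) + 1) * M ^ (j + 1) ≤ ((j : ℝ) + 1) * M' ^ (j + 1) :=
        mul_le_mul_of_nonneg_left (pow_le_pow_left₀ hM0 hMM' _) (by positivity)
      have he := envelope_mono hM'1 hjJ.le
      calc K * ν * ((j : ℝ) + 1) * M ^ (j + 1) = (K * ν) * (((j : ℝ) + 1) * M ^ (j + 1)) := by ring
        _ ≤ (K * ν) * (((JT : ℝ) + 1) * M' ^ (JT + 1)) :=
            mul_le_mul_of_nonneg_left (hm.trans he) (mul_nonneg hK0 hν0.le)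
    have h3 : Real.sqrt (Torus.vectorL2Sq (L s)) ≤ B := h1.trans h2
    calc Torus.vectorL2Sq (L s) = Real.sqrt (Torus.vectorL2Sq (L s)) ^ 2 := (Real.sq_sqrt hV0).symm
      _ ≤ B ^ 2 := pow_le_pow_left₀ (Real.sqrt_nonneg _) h3 2
  -- the time integral
  have hT0 : 0 ≤ tStart JT := tStart_nonneg JT
  have hT1 : tStart JT ≤ 1 := (tStart_lt_one JT).le
  have hcont : ContinuousOn (fun s => Torus.vectorL2Sq (L s)) (Icc 0 (tStart JT)) := by
    have h := hL.continuousOn_integral_norm_sq (convex_Icc 0 T')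
    exact h.mono (Icc_subset_Icc le_rfl hT.le)
  have hint : (∫ s in (0 : ℝ)..tStart JT, Torus.vectorL2Sq (L s)) ≤ B ^ 2 := by
    calc (∫ s in (0 : ℝ)..tStart JT, Torus.vectorL2Sq (L s)) ≤ ∫ _ in (0 : ℝ)..tStart JT, B ^ 2 := by
          refine intervalIntegral.integral_mono_on hT0 (hcont.intervalIntegrable_of_Icc hT0)
            _root_.intervalIntegrable_const fun s hs => hunif s hs
      _ = tStart JT * B ^ 2 := by rw [intervalIntegral.integral_const]; simp
      _ ≤ 1 * B ^ 2 := mul_le_mul_of_nonneg_right hT1 (sq_nonneg _)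
      _ = B ^ 2 := one_mul _
  -- `B² ≤ D ν^{2-θ} ≤ ε ν`
  have henv2 : ((JT : ℝ) + 1) * M' ^ (JT + 1) ≤ c₁ * ρ ^ JT := by
    have hxJ := Literature.MathematicalPhysics.QuantumFieldTheory.Balaban1983to89.T4FlagMemoryPolyWeight.succ_mul_pow_le
      hx0 hx1 JT
    have hM'eq : M' ^ (JT + 1) = M' * (x ^ JT * ρ ^ JT) := by
      rw [← mul_pow, hx, div_mul_cancel₀ _ hρ0.ne', pow_succ, mul_comm]
    rw [hM'eq, hc₁]
    have : ((JT : ℝ) + 1) * (M' * (x ^ JT * ρ ^ JT)) = M' * (((JT : ℝ) + 1) * x ^ JT) * ρ ^ JT := by ring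
    rw [this]
    exact mul_le_mul_of_nonneg_right (mul_le_mul_of_nonneg_left hxJ (by positivity)) (by positivity)
  have hB2 : B ^ 2 ≤ D * ν ^ (2 - θ) := by
    have hB' : B ≤ K * ν * (c₁ * ρ ^ JT) := by
      rw [hB]; exact mul_le_mul_of_nonneg_left henv2 (mul_nonneg hK0 hν0.le)
    have hsq : B ^ 2 ≤ (K * ν * (c₁ * ρ ^ JT)) ^ 2 := pow_le_pow_left₀ hB0 hB' 2
    have hJr : ν * q ^ Jrate (γ ^ 2 - 3) ν ≤ q * ν ^ (1 - θ) := mul_pow_Jrate_le hq1 hr1 hν0 hν1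
    have hρJ : (ρ ^ JT) ^ 2 = q ^ A * q ^ Jrate (γ ^ 2 - 3) ν := by
      rw [hq, hJT, ← pow_mul, mul_comm, pow_mul, ← pow_add, add_comm]
    have hkey : (K * ν * (c₁ * ρ ^ JT)) ^ 2 ≤ D * ν ^ (2 - θ) := by
      have e1 : (K * ν * (c₁ * ρ ^ JT)) ^ 2 = (K * c₁) ^ 2 * q ^ A * ν * (ν * q ^ Jrate (γ ^ 2 - 3) ν) := by
        rw [show (K * ν * (c₁ * ρ ^ JT)) ^ 2 = (K * c₁) ^ 2 * ν ^ 2 * (ρ ^ JT) ^ 2 by ring, hρJ]; ring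
      rw [e1]
      have e2 : (K * c₁) ^ 2 * q ^ A * ν * (q * ν ^ (1 - θ)) = (K * c₁) ^ 2 * q ^ (A + 1) * ν ^ (2 - θ) := by
        rw [show (2 : ℝ) - θ = 1 + (1 - θ) by ring, Real.rpow_add hν0, Real.rpow_one, pow_succ]; ring
      calc (K * c₁) ^ 2 * q ^ A * ν * (ν * q ^ Jrate (γ ^ 2 - 3) ν)
          ≤ (K * c₁) ^ 2 * q ^ A * ν * (q * ν ^ (1 - θ)) := mul_le_mul_of_nonneg_left hJr (by positivity)
        _ = (K * c₁) ^ 2 * q ^ (A + 1) * ν ^ (2 - θ) := e2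
        _ ≤ D * ν ^ (2 - θ) := by
            rw [hD]
            have : 0 ≤ ν ^ (2 - θ) := (Real.rpow_pos_of_pos hν0 _).le
            nlinarith
    exact hsq.trans hkey
  have hfin : D * ν ^ (2 - θ) ≤ ε * ν := by
    have hpow : ν ^ (1 - θ) ≤ ε / D := by
      calc ν ^ (1 - θ) ≤ ν₂ ^ (1 - θ) := Real.rpow_le_rpow hν0.le hνν₂ h1θ.le
        _ = ε / D := by rw [hν₂, one_div, Real.rpow_inv_rpow (div_pos hε hD0).le h1θ.ne']
    calc D * ν ^ (2 - θ) = D * ν ^ (1 - θ) * ν := by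
          rw [show (2 : ℝ) - θ = (1 - θ) + 1 by ring, Real.rpow_add hν0, Real.rpow_one]; ring
      _ ≤ D * (ε / D) * ν := by gcongr
      _ = ε * ν := by field_simp
  exact hint.trans (hB2.trans hfin)

end Summit.AnomalousDissipation.AnomalousDissipation.Theorems.SawtoothPulseCascade.ApproxResponse

end
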